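import Summits.CriticalPhenomena.PercolationContinuityZ3.Theorems.Transplant.D10SKc00_2555P2
import HarnessLib

/-!
# Diamond film `D_10` — KERNEL CERTIFICATE for the class `00_2555` of `ShapedLinkageX 4 (DiamondFilm.sqShadow (k := 10))`, THE CLASS (mask + coverage from the 2 parts) (template `fullmcp`, |W| = 205, 2162 terminal pairs, 7337 plans)

builds on p205010 (kernel theorem, internal audit signed; external expert review pending) — NOT used in this file.  Lane `prim-bschramm`, seat `prim-bschramm-p2` (gen 43; class C1b;
memo `HOME/bschramm/P2-LATTICES.md` §152); helper file (`--supports stmt-CriticalPhenomena-4575 --as helper`).  Generated by `cert/emit_dk.py` from the plans of `cert/gen_dk.py`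
(canonical BFS routings with avoid hints, exact mirror `cert/kern_dk.py` of «DkSKDefs»); re-checked here by the kernel (`DCtx.checkEs`); `caseOK_k10_00_2555` feeds «D10SKFinal».
[cite: DuminilCopinSidoraviciusTassion2016, §2.3 (proof of Fact 2: the three disjoint paths in B_R(z))]
-/

namespace Summit.CriticalPhenomena.PercolationContinuityZ3.Theorems.Transplant

namespace DiamondFilm.DK

/-- The cleared mask of the class `00_2555` of `D_10` is admissible (inside the cleared block, containing the forced core). [folklore] -/
theorem wOK_k10_00_2555 : DCtx.wOK (⟨10, 0, 0, 2, 5, 5, 5, 27153899133233802839723450954739071872663075353486206048355967141324775202092079510789140670186288472224241336677129601024⟩ : DCtx) = true := by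
  decide +kernel

/-- **THE CLASS `00_2555` OF `D_10` IS COVERED**: every needed bit of every certified terminal pair has a swap-pair plan. [cite: DuminilCopinSidoraviciusTassion2016, §2.3 (proof of Fact 2)] -/
theorem caseOK_k10_00_2555 : CaseOK (⟨10, 0, 0, 2, 5, 5, 5, 27153899133233802839723450954739071872663075353486206048355967141324775202092079510789140670186288472224241336677129601024⟩ : DCtx) :=
  caseOK_of_chunks _ [[14, 16, 18], [20, 25, 27], [29, 31, 33], [49, 57, 73], [81, 158, 159], [160, 161, 162], [163, 164, 169], [177, 181, 189], [193, 201, 205], [213, 217, 225], [229, 237, 303], [305, 307, 313], [321, 325, 333], [337, 345, 349], [357, 361, 369], [373, 381]]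
    (List.forall_mem_cons.2 ⟨checkEs_sound _ _ _ chunk_k10_00_2555_0, List.forall_mem_cons.2 ⟨checkEs_sound _ _ _ chunk_k10_00_2555_1, List.forall_mem_cons.2 ⟨checkEs_sound _ _ _ chunk_k10_00_2555_2, List.forall_mem_cons.2 ⟨checkEs_sound _ _ _ chunk_k10_00_2555_3, List.forall_mem_cons.2 ⟨checkEs_sound _ _ _ chunk_k10_00_2555_4, List.forall_mem_cons.2 ⟨checkEs_sound _ _ _ chunk_k10_00_2555_5, List.forall_mem_cons.2 ⟨checkEs_sound _ _ _ chunk_k10_00_2555_6, List.forall_mem_cons.2 ⟨checkEs_sound _ _ _ chunk_k10_00_2555_7, List.forall_mem_cons.2 ⟨checkEs_sound _ _ _ chunk_k10_00_2555_8, List.forall_mem_cons.2 ⟨checkEs_sound _ _ _ chunk_k10_00_2555_9, List.forall_mem_cons.2 ⟨checkEs_sound _ _ _ chunk_k10_00_2555_10, List.forall_mem_cons.2 ⟨checkEs_sound _ _ _ chunk_k10_00_2555_11, List.forall_mem_cons.2 ⟨checkEs_sound _ _ _ chunk_k10_00_2555_12, List.forall_mem_cons.2 ⟨checkEs_sound _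 _ _ chunk_k10_00_2555_13, List.forall_mem_cons.2 ⟨checkEs_sound _ _ _ chunk_k10_00_2555_14, List.forall_mem_cons.2 ⟨checkEs_sound _ _ _ chunk_k10_00_2555_15, List.forall_mem_nil _⟩⟩⟩⟩⟩⟩⟩⟩⟩⟩⟩⟩⟩⟩⟩⟩)
    (by decide +kernel)

end DiamondFilm.DK

end Summit.CriticalPhenomena.PercolationContinuityZ3.Theorems.Transplant
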